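import Summits.QuantumFields.YangMills.Theorems.FemtoCurvatureSkewness.Negative.WeakCoupling

/-!
# `FemtoCurvatureSkewness` — real-analyticity in the coupling: `β ↦ ∫ e^{-βS} F`, `β ↦ E_β[F]`, `β ↦ κ₃(L,β,n)`

Helper for stub `GlobalSkewSign` (line `coupling-cubic-response`, crux `stmt-QuantumFields-9365`): the structural input
every fixed-torus sign / zero-counting argument for the crux cumulant uses.  Tree objects only; no `sorry`.

* §1 (general): for a finite measure `μ` and bounded measurable `S`, `F`, the Laplace-type parametric integral
  `β ↦ ∫ e^{-β S} F dμ` is the sum of an everywhere-convergent power series around every centre `β₀`, coefficients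
  `∫ (-S)^k/k! · e^{-β₀ S} F dμ` (dominated exchange of sum and integral): `hasFPowerSeriesOnBall_integral_exp_mul`,
  `analyticOnNhd_integral_exp_mul`, `iteratedDeriv_integral_exp_mul` (`∂_β^k ∫ e^{-βS}F = ∫ (-S)^k e^{-βS} F`).
* §2 (torus Wilson theory, `S` = Wilson action — continuous on the compact configuration space —, `μ` = product Haar):
  `hasFPowerSeriesOnBall_integral_exp_wilsonAction`, `analyticOnNhd_integral_exp_wilsonAction`,
  `iteratedDeriv_integral_exp_wilsonAction`, `hasDerivAt_integral_exp_wilsonAction`; `analyticOnNhd_wE` (the Wilson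
  expectation of a continuous observable is real-analytic in `β`: quotient by the nowhere-vanishing real-analytic
  `∫ e^{-βS}`), `contDiff_wE`, `hasDerivAt_wE` / `deriv_wE` (**`d/dβ E_β[F] = -Cov_β(S, F)`**), `analyticOnNhd_wCov`,
  `analyticOnNhd_kappa3`.
* Zero sets: `kappa3_eqOn_zero_of_frequently_eq_zero` (identity principle), `kappa3_zero_set_dichotomy` (on each fixed
  torus either `κ₃(L,·,n) ≡ 0` on `ℝ` or its zeros are isolated), `kappa3_eq_zero_or_codiscrete_ne_zero`,
  `kappa3_eq_zero_or_finite_zeros` / `kappa3_finite_zeros_Icc_of_ne_zero` (finitely many zeros in every compact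
  coupling window unless identically zero).
-/

noncomputable section

namespace Summit.QuantumFields.YangMills.Theorems.FemtoCurvatureSkewness

open MeasureTheory Filter Topology
open scoped Nat NNReal ENNReal
open Literature.MathematicalPhysics.QuantumFieldTheory
open Summit.QuantumFields.YangMills.Theorems.ContinuumLimitOnTrajectory.Negative
open Summit.QuantumFields.YangMills.Theorems.FemtoCurvatureSkewness.Negative

/-! ## §1 Laplace-type parametric integrals of bounded data are entire -/

section Laplace

variable {X : Type*}

/-- A continuous real function on a compact space is bounded. -/
theorem exists_abs_le_of_continuous [TopologicalSpace X] [CompactSpace X] {F : X → ℝ} (hF : Continuous F) :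
    ∃ K : ℝ, ∀ x, |F x| ≤ K := by
  obtain ⟨K, hK⟩ := isCompact_univ.exists_bound_of_continuousOn hF.continuousOn
  exact ⟨K, fun x => by simpa using hK x (Set.mem_univ x)⟩

/-- Taylor-term bound: `|(-S)^k/k! · F| ≤ M^k/k! · K` when `|S| ≤ M`, `|F| ≤ K`. -/
theorem abs_taylorTerm_le {S F : X → ℝ} {M K : ℝ} (hSM : ∀ x, |S x| ≤ M) (hFK : ∀ x, |F x| ≤ K)
    (k : ℕ) (x : X) : |(-S x) ^ k / k ! * F x| ≤ M ^ k / k ! * K := by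
  have hM : 0 ≤ M := (abs_nonneg _).trans (hSM x)
  have h1 : |S x| ^ k ≤ M ^ k := pow_le_pow_left₀ (abs_nonneg _) (hSM x) k
  rw [abs_mul, abs_div, abs_pow, abs_neg, Nat.abs_cast]
  calc |S x| ^ k / (k ! : ℝ) * |F x| = |S x| ^ k * |F x| / (k ! : ℝ) := by ring
    _ ≤ M ^ k * K / (k ! : ℝ) := by
        apply div_le_div_of_nonneg_right _ (by positivity)
        exact mul_le_mul h1 (hFK x) (abs_nonneg _) (pow_nonneg hM k)
    _ = M ^ k / k ! * K := by ring

/-- The same bound with the power of the increment: `‖(-S)^k/k! · F · y^k‖ ≤ (M|y|)^k/k! · K`. -/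
theorem norm_taylorTerm_mul_pow_le {S F : X → ℝ} {M K : ℝ} (hSM : ∀ x, |S x| ≤ M) (hFK : ∀ x, |F x| ≤ K)
    (k : ℕ) (y : ℝ) (x : X) : ‖(-S x) ^ k / k ! * F x * y ^ k‖ ≤ (M * |y|) ^ k / k ! * K := by
  rw [Real.norm_eq_abs, abs_mul ((-S x) ^ k / k ! * F x), abs_pow]
  calc |(-S x) ^ k / ↑k ! * F x| * |y| ^ k ≤ M ^ k / ↑k ! * K * |y| ^ k :=
        mul_le_mul_of_nonneg_right (abs_taylorTerm_le hSM hFK k x) (pow_nonneg (abs_nonneg _) k)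
    _ = (M * |y|) ^ k / k ! * K := by ring

variable [MeasurableSpace X] {μ : Measure X} [IsFiniteMeasure μ]

/-- **Laplace-type parametric integrals of bounded data are entire** (centre `0`): for bounded measurable `S`, `F`
on a finite measure space, `β ↦ ∫ e^{-β S} F dμ = Σ_k β^k ∫ (-S)^k/k! F dμ` with infinite radius of convergence. -/
theorem hasFPowerSeriesOnBall_integral_exp_mul_zero {S F : X → ℝ} (hS : Measurable S) (hF : Measurable F)
    {M K : ℝ} (hSM : ∀ x, |S x| ≤ M) (hFK : ∀ x, |F x| ≤ K) :
    HasFPowerSeriesOnBall (fun β : ℝ => ∫ x, Real.exp (-β * S x) * F x ∂μ)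
      (FormalMultilinearSeries.ofScalars ℝ fun k => ∫ x, (-S x) ^ k / k ! * F x ∂μ) 0 ⊤ where
  r_le := by
    refine le_of_eq (FormalMultilinearSeries.radius_eq_top_of_summable_norm _ fun r => ?_).symm
    have hbound : ∀ k : ℕ,
        ‖FormalMultilinearSeries.ofScalars ℝ (fun k => ∫ x, (-S x) ^ k / k ! * F x ∂μ) k‖ * (r : ℝ) ^ k ≤
          (M * r) ^ k / k ! * (K * μ.real Set.univ) := by
      intro k
      rw [FormalMultilinearSeries.ofScalars_norm]
      have h1 : ‖∫ x, (-S x) ^ k / k ! * F x ∂μ‖ ≤ M ^ k / k ! * K * μ.real Set.univ :=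
        norm_integral_le_of_norm_le_const (Eventually.of_forall fun x => abs_taylorTerm_le hSM hFK k x)
      calc ‖∫ x, (-S x) ^ k / k ! * F x ∂μ‖ * (r : ℝ) ^ k ≤ M ^ k / k ! * K * μ.real Set.univ * (r : ℝ) ^ k :=
            mul_le_mul_of_nonneg_right h1 (by positivity)
        _ = (M * r) ^ k / k ! * (K * μ.real Set.univ) := by ring
    exact Summable.of_nonneg_of_le (fun k => by positivity) hbound
      ((Real.summable_pow_div_factorial (M * r)).mul_right _)
  r_pos := ENNReal.zero_lt_top
  hasSum := by
    intro y _
    simp only [FormalMultilinearSeries.ofScalars_apply_eq, smul_eq_mul, zero_add]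
    have heq : (fun n => (∫ x, (-S x) ^ n / n ! * F x ∂μ) * y ^ n) =
        fun n => ∫ x, (-S x) ^ n / n ! * F x * y ^ n ∂μ := by
      funext n
      exact (integral_mul_const (y ^ n) _).symm
    rw [heq]
    refine hasSum_integral_of_dominated_convergence (fun n _ => (M * |y|) ^ n / n ! * K) (fun n => ?_)
      (fun n => Eventually.of_forall fun x => norm_taylorTerm_mul_pow_le hSM hFK n y x) ?_ ?_ ?_
    · have : Measurable fun x => (-S x) ^ n / n ! * F x * y ^ n := by fun_prop
      exact this.aestronglyMeasurable
    · exact Eventually.of_forall fun _ => (Real.summable_pow_div_factorial (M * |y|)).mul_right K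
    · exact integrable_const _
    · refine Eventually.of_forall fun x => ?_
      have h := (NormedSpace.expSeries_div_hasSum_exp (-y * S x)).mul_right (F x)
      rw [← congr_fun Real.exp_eq_exp_ℝ (-y * S x)] at h
      have hfn : (fun n => (-S x) ^ n / n ! * F x * y ^ n) = fun n => (-y * S x) ^ n / n ! * F x := by
        funext n
        ring
      rw [hfn]
      exact h

/-- **Laplace-type parametric integrals of bounded data are entire** (every centre `β₀`): the power series of
`β ↦ ∫ e^{-β S} F dμ` around `β₀` has coefficients `∫ (-S)^k/k! · e^{-β₀ S} F dμ` and infinite radius. -/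
theorem hasFPowerSeriesOnBall_integral_exp_mul {S F : X → ℝ} (hS : Measurable S) (hF : Measurable F)
    {M K : ℝ} (hSM : ∀ x, |S x| ≤ M) (hFK : ∀ x, |F x| ≤ K) (β₀ : ℝ) :
    HasFPowerSeriesOnBall (fun β : ℝ => ∫ x, Real.exp (-β * S x) * F x ∂μ)
      (FormalMultilinearSeries.ofScalars ℝ fun k =>
        ∫ x, (-S x) ^ k / k ! * (Real.exp (-β₀ * S x) * F x) ∂μ) β₀ ⊤ := by
  have hF' : Measurable fun x => Real.exp (-β₀ * S x) * F x :=
    (Real.measurable_exp.comp (hS.const_mul (-β₀))).mul hF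
  have hF'K : ∀ x, |Real.exp (-β₀ * S x) * F x| ≤ Real.exp (|β₀| * M) * K := fun x => by
    have hle : -β₀ * S x ≤ |β₀| * M :=
      calc -β₀ * S x ≤ |-β₀ * S x| := le_abs_self _
        _ = |β₀| * |S x| := by rw [abs_mul, abs_neg]
        _ ≤ |β₀| * M := mul_le_mul_of_nonneg_left (hSM x) (abs_nonneg _)
    rw [abs_mul, abs_of_pos (Real.exp_pos _)]
    exact mul_le_mul (Real.exp_le_exp.2 hle) (hFK x) (abs_nonneg _) (Real.exp_pos _).le
  have hg := hasFPowerSeriesOnBall_integral_exp_mul_zero (μ := μ) hS hF' hSM hF'K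
  refine ⟨hg.r_le, hg.r_pos, fun {y} hy => ?_⟩
  have h1 := hg.hasSum hy
  have hfun : (fun x => Real.exp (-(β₀ + y) * S x) * F x) =
      fun x => Real.exp (-y * S x) * (Real.exp (-β₀ * S x) * F x) := by
    funext x
    rw [show -(β₀ + y) * S x = -y * S x + -β₀ * S x by ring, Real.exp_add, mul_assoc]
  simp only [zero_add] at h1
  simp only [hfun]
  exact h1

/-- Hence `β ↦ ∫ e^{-β S} F dμ` is real-analytic on all of `ℝ`. -/
theorem analyticOnNhd_integral_exp_mul {S F : X → ℝ} (hS : Measurable S) (hF : Measurable F)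
    {M K : ℝ} (hSM : ∀ x, |S x| ≤ M) (hFK : ∀ x, |F x| ≤ K) :
    AnalyticOnNhd ℝ (fun β : ℝ => ∫ x, Real.exp (-β * S x) * F x ∂μ) Set.univ := fun β _ =>
  (hasFPowerSeriesOnBall_integral_exp_mul_zero (μ := μ) hS hF hSM hFK).analyticAt_of_mem
    (Metric.mem_eball.2 (edist_lt_top β 0))

/-- **Differentiation under the integral sign, all orders**: `∂_β^k ∫ e^{-β S} F dμ = ∫ (-S)^k e^{-β S} F dμ`. -/
theorem iteratedDeriv_integral_exp_mul {S F : X → ℝ} (hS : Measurable S) (hF : Measurable F)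
    {M K : ℝ} (hSM : ∀ x, |S x| ≤ M) (hFK : ∀ x, |F x| ≤ K) (k : ℕ) (β₀ : ℝ) :
    iteratedDeriv k (fun β : ℝ => ∫ x, Real.exp (-β * S x) * F x ∂μ) β₀ =
      ∫ x, (-S x) ^ k * (Real.exp (-β₀ * S x) * F x) ∂μ := by
  have h := hasFPowerSeriesOnBall_integral_exp_mul (μ := μ) hS hF hSM hFK β₀
  have h1 := h.factorial_smul 1 k
  rw [iteratedDeriv_eq_iteratedFDeriv, ← h1, FormalMultilinearSeries.ofScalars_apply_eq, one_pow, smul_eq_mul,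
    mul_one, nsmul_eq_mul, ← integral_const_mul]
  congr 1
  funext x
  have hk : (k ! : ℝ) ≠ 0 := by positivity
  field_simp

end Laplace

/-! ## §2 The torus Wilson theory: `∫ e^{-βS} F dHaar^{⊗E}`, `E_β[F]` and `κ₃` are real-analytic in `β` -/

section Wilson

variable {G : Type} [Group G] [TopologicalSpace G] [IsTopologicalGroup G] [CompactSpace G]
  [MeasurableSpace G] [BorelSpace G]

omit [MeasurableSpace G] [BorelSpace G] in
/-- The Wilson action is bounded on the (compact) torus configuration space. -/
theorem exists_abs_wilsonAction_le (r : LatticeRep G) (L : ℕ) [NeZero L] :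
    ∃ M : ℝ, ∀ U : GaugeConfig 4 L G, |wilsonAction (d := 4) (L := L) r.ρ U| ≤ M :=
  exists_abs_le_of_continuous
    (Literature.Barriers.QuantumFields.Elitzur.continuous_wilsonAction (d := 4) (L := L) r.ρ r.continuous)

/-- **`β ↦ ∫ e^{-βS} F dHaar^{⊗E}` is entire** for the torus Wilson action `S` and every continuous observable `F`:
power series around every `β₀` with coefficients `∫ (-S)^k/k! e^{-β₀ S} F dHaar^{⊗E}` and infinite radius. -/
theorem hasFPowerSeriesOnBall_integral_exp_wilsonAction (r : LatticeRep G) (L : ℕ) [NeZero L]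
    {F : GaugeConfig 4 L G → ℝ} (hF : Continuous F) (β₀ : ℝ) :
    HasFPowerSeriesOnBall
      (fun β : ℝ => ∫ U, Real.exp (-β * wilsonAction (d := 4) (L := L) r.ρ U) * F U ∂piHaar L)
      (FormalMultilinearSeries.ofScalars ℝ fun k =>
        ∫ U, (-wilsonAction (d := 4) (L := L) r.ρ U) ^ k / k ! *
          (Real.exp (-β₀ * wilsonAction (d := 4) (L := L) r.ρ U) * F U) ∂piHaar L) β₀ ⊤ := by
  haveI : SecondCountableTopology G :=
    (r.continuous.isClosedEmbedding r.injective).isEmbedding.secondCountableTopology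
  have hS : Continuous (wilsonAction (d := 4) (L := L) r.ρ : GaugeConfig 4 L G → ℝ) :=
    Literature.Barriers.QuantumFields.Elitzur.continuous_wilsonAction r.ρ r.continuous
  obtain ⟨M, hM⟩ := exists_abs_wilsonAction_le r L
  obtain ⟨K, hK⟩ := exists_abs_le_of_continuous hF
  exact hasFPowerSeriesOnBall_integral_exp_mul hS.measurable hF.measurable hM hK β₀

/-- **`β ↦ ∫ e^{-βS} F dHaar^{⊗E}` is real-analytic on `ℝ`** (torus Wilson action, continuous `F`). -/
theorem analyticOnNhd_integral_exp_wilsonAction (r : LatticeRep G) (L : ℕ) [NeZero L]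
    {F : GaugeConfig 4 L G → ℝ} (hF : Continuous F) :
    AnalyticOnNhd ℝ
      (fun β : ℝ => ∫ U, Real.exp (-β * wilsonAction (d := 4) (L := L) r.ρ U) * F U ∂piHaar L) Set.univ :=
  fun β _ => (hasFPowerSeriesOnBall_integral_exp_wilsonAction r L hF β).analyticAt

/-- **Differentiation under the Haar integral, all orders**: `∂_β^k ∫ e^{-βS} F = ∫ (-S)^k e^{-βS} F`. -/
theorem iteratedDeriv_integral_exp_wilsonAction (r : LatticeRep G) (L : ℕ) [NeZero L]
    {F : GaugeConfig 4 L G → ℝ} (hF : Continuous F) (k : ℕ) (β₀ : ℝ) :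
    iteratedDeriv k (fun β : ℝ => ∫ U, Real.exp (-β * wilsonAction (d := 4) (L := L) r.ρ U) * F U ∂piHaar L) β₀ =
      ∫ U, (-wilsonAction (d := 4) (L := L) r.ρ U) ^ k *
        (Real.exp (-β₀ * wilsonAction (d := 4) (L := L) r.ρ U) * F U) ∂piHaar L := by
  haveI : SecondCountableTopology G :=
    (r.continuous.isClosedEmbedding r.injective).isEmbedding.secondCountableTopology
  have hS : Continuous (wilsonAction (d := 4) (L := L) r.ρ : GaugeConfig 4 L G → ℝ) :=
    Literature.Barriers.QuantumFields.Elitzur.continuous_wilsonAction r.ρ r.continuous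
  obtain ⟨M, hM⟩ := exists_abs_wilsonAction_le r L
  obtain ⟨K, hK⟩ := exists_abs_le_of_continuous hF
  exact iteratedDeriv_integral_exp_mul hS.measurable hF.measurable hM hK k β₀

/-- `Z(β)⁻¹` read off `E_β[1] = 1`: `(Z(β)⁻¹).toReal = (∫ e^{-βS} dHaar^{⊗E})⁻¹`, and the Haar integral is non-zero. -/
theorem toReal_inv_partitionFunction (r : LatticeRep G) (L : ℕ) [NeZero L] (β : ℝ) :
    ((partitionFunction (d := 4) (L := L) r.ρ β)⁻¹).toReal =
        (∫ U, Real.exp (-β * wilsonAction (d := 4) (L := L) r.ρ U) * (1 : ℝ) ∂piHaar L)⁻¹ ∧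
      (∫ U, Real.exp (-β * wilsonAction (d := 4) (L := L) r.ρ U) * (1 : ℝ) ∂piHaar L) ≠ 0 := by
  have hone : wE r L β (fun _ => (1 : ℝ)) = 1 := by
    haveI := isProbabilityMeasure_wilsonMeasure (d := 4) (L := L) r.ρ r.continuous β
    simp [wE, wilsonExpectation]
  refine ⟨?_, fun h0 => ?_⟩
  · have h1 := hone
    rw [wE_eq_inv_mul_integral] at h1
    exact eq_inv_of_mul_eq_one_left h1
  · have h1 := hone
    rw [wE_eq_inv_mul_integral, h0, mul_zero] at h1
    exact zero_ne_one h1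

/-- `E_β[F] = (∫ e^{-βS})⁻¹ ∫ e^{-βS} F` as functions of `β`. -/
theorem wE_eq_integral_inv_mul (r : LatticeRep G) (L : ℕ) [NeZero L] (F : GaugeConfig 4 L G → ℝ) :
    (fun β => wE r L β F) = fun β =>
      (∫ U, Real.exp (-β * wilsonAction (d := 4) (L := L) r.ρ U) * (1 : ℝ) ∂piHaar L)⁻¹ *
        ∫ U, Real.exp (-β * wilsonAction (d := 4) (L := L) r.ρ U) * F U ∂piHaar L :=
  funext fun β => by rw [wE_eq_inv_mul_integral, (toReal_inv_partitionFunction r L β).1]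

/-- **The torus Wilson expectation of a continuous observable is real-analytic in the coupling** on all of `ℝ`
(quotient of two entire functions, the denominator `∫ e^{-βS} dHaar^{⊗E}` never vanishing). -/
theorem analyticOnNhd_wE (r : LatticeRep G) (L : ℕ) [NeZero L] {F : GaugeConfig 4 L G → ℝ} (hF : Continuous F) :
    AnalyticOnNhd ℝ (fun β => wE r L β F) Set.univ := by
  have hN := analyticOnNhd_integral_exp_wilsonAction r L hF
  have hD := analyticOnNhd_integral_exp_wilsonAction r L (F := fun _ => (1 : ℝ)) continuous_const
  rw [wE_eq_integral_inv_mul]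
  exact (hD.inv fun β _ => (toReal_inv_partitionFunction r L β).2).mul hN

/-- Pointwise form: `β ↦ E_β[F]` is analytic at every `β`. -/
theorem analyticAt_wE (r : LatticeRep G) (L : ℕ) [NeZero L] {F : GaugeConfig 4 L G → ℝ} (hF : Continuous F)
    (β : ℝ) : AnalyticAt ℝ (fun β => wE r L β F) β :=
  analyticOnNhd_wE r L hF β (Set.mem_univ β)

/-- The Wilson expectation of a continuous observable is smooth in the coupling. -/
theorem contDiff_wE (r : LatticeRep G) (L : ℕ) [NeZero L] {F : GaugeConfig 4 L G → ℝ} (hF : Continuous F)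
    {m : WithTop ℕ∞} : ContDiff ℝ m (fun β => wE r L β F) :=
  (analyticOnNhd_wE r L hF).contDiff

/-- **First β-derivative under the Haar integral**: `d/dβ ∫ e^{-βS} F = ∫ (-S) e^{-βS} F`. -/
theorem hasDerivAt_integral_exp_wilsonAction (r : LatticeRep G) (L : ℕ) [NeZero L]
    {F : GaugeConfig 4 L G → ℝ} (hF : Continuous F) (β₀ : ℝ) :
    HasDerivAt (fun β : ℝ => ∫ U, Real.exp (-β * wilsonAction (d := 4) (L := L) r.ρ U) * F U ∂piHaar L)
      (∫ U, -wilsonAction (d := 4) (L := L) r.ρ U *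
        (Real.exp (-β₀ * wilsonAction (d := 4) (L := L) r.ρ U) * F U) ∂piHaar L) β₀ := by
  have hd := ((analyticOnNhd_integral_exp_wilsonAction r L hF) β₀ (Set.mem_univ β₀)).differentiableAt
  have h1 := iteratedDeriv_integral_exp_wilsonAction r L hF 1 β₀
  simp only [iteratedDeriv_one, pow_one] at h1
  rw [← h1]
  exact hd.hasDerivAt

/-- **The Wilson action is conjugate to the coupling**: `d/dβ E_β[F] = -Cov_β(S, F)` for every continuous
observable `F` on a fixed torus (`S` the Wilson action). -/
theorem hasDerivAt_wE (r : LatticeRep G) (L : ℕ) [NeZero L] {F : GaugeConfig 4 L G → ℝ} (hF : Continuous F)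
    (β₀ : ℝ) :
    HasDerivAt (fun β => wE r L β F) (-(wCov r L β₀ (wilsonAction (d := 4) (L := L) r.ρ) F)) β₀ := by
  have hN := hasDerivAt_integral_exp_wilsonAction r L hF β₀
  have hD := hasDerivAt_integral_exp_wilsonAction r L (F := fun _ => (1 : ℝ)) continuous_const β₀
  obtain ⟨hZ, hD0⟩ := toReal_inv_partitionFunction r L β₀
  have hq := (hD.inv hD0).mul hN
  rw [wE_eq_integral_inv_mul]
  refine hq.congr_deriv ?_
  have e1 : ∫ U, -wilsonAction (d := 4) (L := L) r.ρ U *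
        (Real.exp (-β₀ * wilsonAction (d := 4) (L := L) r.ρ U) * F U) ∂piHaar L =
      -∫ U, Real.exp (-β₀ * wilsonAction (d := 4) (L := L) r.ρ U) *
        (wilsonAction (d := 4) (L := L) r.ρ U * F U) ∂piHaar L := by
    rw [← integral_neg]; congr 1; funext U; ring
  have e2 : ∫ U, -wilsonAction (d := 4) (L := L) r.ρ U *
        (Real.exp (-β₀ * wilsonAction (d := 4) (L := L) r.ρ U) * (1 : ℝ)) ∂piHaar L =
      -∫ U, Real.exp (-β₀ * wilsonAction (d := 4) (L := L) r.ρ U) *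
        wilsonAction (d := 4) (L := L) r.ρ U ∂piHaar L := by
    rw [← integral_neg]; congr 1; funext U; ring
  rw [e1, e2, wCov, wE_eq_inv_mul_integral, wE_eq_inv_mul_integral, wE_eq_inv_mul_integral, hZ]
  simp only [Pi.inv_apply]
  ring

/-- `deriv` form of `hasDerivAt_wE`: `(E_·[F])'(β) = -Cov_β(S, F)`. -/
theorem deriv_wE (r : LatticeRep G) (L : ℕ) [NeZero L] {F : GaugeConfig 4 L G → ℝ} (hF : Continuous F)
    (β₀ : ℝ) : deriv (fun β => wE r L β F) β₀ = -(wCov r L β₀ (wilsonAction (d := 4) (L := L) r.ρ) F) :=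
  (hasDerivAt_wE r L hF β₀).deriv

/-- Covariances of continuous observables are real-analytic in the coupling. -/
theorem analyticOnNhd_wCov (r : LatticeRep G) (L : ℕ) [NeZero L] {F F' : GaugeConfig 4 L G → ℝ}
    (hF : Continuous F) (hF' : Continuous F') : AnalyticOnNhd ℝ (fun β => wCov r L β F F') Set.univ := by
  have h := (analyticOnNhd_wE r L (hF.mul hF')).sub ((analyticOnNhd_wE r L hF).mul (analyticOnNhd_wE r L hF'))
  simpa only [wCov, Pi.sub_def, Pi.mul_def] using h

/-- **The crux's cumulant `β ↦ κ₃(L, β, n)` is real-analytic on `ℝ`** on every fixed torus. -/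
theorem analyticOnNhd_kappa3 (r : LatticeRep G) (L : ℕ) [NeZero L] (n : ℕ) :
    AnalyticOnNhd ℝ (fun β => kappa3 r L β n) Set.univ := by
  have hP : ∀ x : Site 4 L, AnalyticOnNhd ℝ (fun β => wE r L β (plaq r L x 0 1)) Set.univ :=
    fun x => analyticOnNhd_wE r L (continuous_plaq r L x 0 1)
  have hPP : ∀ x x' : Site 4 L,
      AnalyticOnNhd ℝ (fun β => wE r L β (fun U => plaq r L x 0 1 U * plaq r L x' 0 1 U)) Set.univ :=
    fun x x' => analyticOnNhd_wE r L ((continuous_plaq r L x 0 1).mul (continuous_plaq r L x' 0 1))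
  have hPPP : ∀ x x' x'' : Site 4 L, AnalyticOnNhd ℝ (fun β =>
      wE r L β (fun U => plaq r L x 0 1 U * plaq r L x' 0 1 U * plaq r L x'' 0 1 U)) Set.univ :=
    fun x x' x'' => analyticOnNhd_wE r L
      (((continuous_plaq r L x 0 1).mul (continuous_plaq r L x' 0 1)).mul (continuous_plaq r L x'' 0 1))
  set y : Site 4 L := Pi.single (2 : Fin 4) ((n : ℕ) : ZMod L) with hy
  set z : Site 4 L := Pi.single (3 : Fin 4) ((n : ℕ) : ZMod L) with hz
  have key := ((((hPPP 0 y z).sub ((hP 0).mul ((hPP y z).sub ((hP y).mul (hP z))))).sub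
    ((hP y).mul ((hPP 0 z).sub ((hP 0).mul (hP z))))).sub
    ((hP z).mul ((hPP 0 y).sub ((hP 0).mul (hP y))))).sub (((hP 0).mul (hP y)).mul (hP z))
  simpa only [kappa3, wCov, hy, hz, Pi.sub_def, Pi.mul_def] using key

/-- Pointwise form: `β ↦ κ₃(L, β, n)` is analytic at every `β`. -/
theorem analyticAt_kappa3 (r : LatticeRep G) (L : ℕ) [NeZero L] (n : ℕ) (β : ℝ) :
    AnalyticAt ℝ (fun β => kappa3 r L β n) β :=
  analyticOnNhd_kappa3 r L n β (Set.mem_univ β)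

/-- **Identity principle for the cumulant**: if the zeros of `β ↦ κ₃(L, β, n)` accumulate at some `β₀` (zeros in every
punctured neighbourhood), then `κ₃(L, ·, n) ≡ 0` on `ℝ`. -/
theorem kappa3_eqOn_zero_of_frequently_eq_zero (r : LatticeRep G) (L : ℕ) [NeZero L] (n : ℕ) {β₀ : ℝ}
    (h : ∃ᶠ β in 𝓝[≠] β₀, kappa3 r L β n = 0) (β : ℝ) : kappa3 r L β n = 0 :=
  (analyticOnNhd_kappa3 r L n).eqOn_zero_of_preconnected_of_frequently_eq_zero isPreconnected_univ
    (Set.mem_univ β₀) h (Set.mem_univ β)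

/-- **Zero-set dichotomy** (principle of isolated zeros): on each fixed torus, either the crux cumulant vanishes
identically in the coupling, or every `β₀` has a punctured neighbourhood free of zeros of `κ₃(L, ·, n)`. -/
theorem kappa3_zero_set_dichotomy (r : LatticeRep G) (L : ℕ) [NeZero L] (n : ℕ) :
    (∀ β : ℝ, kappa3 r L β n = 0) ∨ ∀ β₀ : ℝ, ∀ᶠ β in 𝓝[≠] β₀, kappa3 r L β n ≠ 0 := by
  by_cases h : ∀ β₀ : ℝ, ∀ᶠ β in 𝓝[≠] β₀, kappa3 r L β n ≠ 0
  · exact Or.inr h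
  · left
    obtain ⟨β₀, hβ₀⟩ := not_forall.1 h
    have hfr : ∃ᶠ β in 𝓝[≠] β₀, kappa3 r L β n = 0 :=
      (Filter.not_eventually.1 hβ₀).mono fun _ hb => not_ne_iff.1 hb
    exact kappa3_eqOn_zero_of_frequently_eq_zero r L n hfr

/-- Codiscrete form of the dichotomy: `κ₃(L, ·, n) ≡ 0` or `κ₃ ≠ 0` on a codiscrete subset of `ℝ`. -/
theorem kappa3_eq_zero_or_codiscrete_ne_zero (r : LatticeRep G) (L : ℕ) [NeZero L] (n : ℕ) :
    (∀ β : ℝ, kappa3 r L β n = 0) ∨ ∀ᶠ β in codiscreteWithin (Set.univ : Set ℝ), kappa3 r L β n ≠ 0 := by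
  rcases (analyticOnNhd_kappa3 r L n).eqOn_zero_or_eventually_ne_zero_of_preconnected isPreconnected_univ with h | h
  · exact Or.inl fun β => h (Set.mem_univ β)
  · exact Or.inr h

/-- A single non-zero value excludes the degenerate branch: if `κ₃(L, β₁, n) ≠ 0` for some `β₁`, then the zeros of
`κ₃(L, ·, n)` are isolated. -/
theorem kappa3_zeros_isolated_of_ne_zero (r : LatticeRep G) (L : ℕ) [NeZero L] (n : ℕ) {β₁ : ℝ}
    (h : kappa3 r L β₁ n ≠ 0) (β₀ : ℝ) : ∀ᶠ β in 𝓝[≠] β₀, kappa3 r L β n ≠ 0 := by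
  rcases kappa3_zero_set_dichotomy r L n with h0 | h0
  · exact absurd (h0 β₁) h
  · exact h0 β₀

/-- **Finitely many zeros in every compact coupling window** unless identically zero: on each fixed torus, either
`κ₃(L, ·, n) ≡ 0` or `{β ∈ K | κ₃(L, β, n) = 0}` is finite for every compact `K ⊆ ℝ` (e.g. `K = [b₁, b₂]`). -/
theorem kappa3_eq_zero_or_finite_zeros (r : LatticeRep G) (L : ℕ) [NeZero L] (n : ℕ) :
    (∀ β : ℝ, kappa3 r L β n = 0) ∨ ∀ K : Set ℝ, IsCompact K → {β ∈ K | kappa3 r L β n = 0}.Finite := by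
  rcases kappa3_eq_zero_or_codiscrete_ne_zero r L n with h | h
  · exact Or.inl h
  · refine Or.inr fun K hK => ?_
    have hK' : {β | kappa3 r L β n ≠ 0} ∈ codiscreteWithin K := Filter.codiscreteWithin_mono (Set.subset_univ K) h
    refine (hK.finite_sdiff_of_mem_codiscreteWithin hK').subset fun β hβ => ?_
    exact ⟨hβ.1, fun hne => hne hβ.2⟩

/-- In particular a single non-zero value `κ₃(L, β₁, n) ≠ 0` makes the zero set of `κ₃(L, ·, n)` finite in every
compact interval `[b₁, b₂]`. -/
theorem kappa3_finite_zeros_Icc_of_ne_zero (r : LatticeRep G) (L : ℕ) [NeZero L] (n : ℕ) {β₁ : ℝ}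
    (h : kappa3 r L β₁ n ≠ 0) (b₁ b₂ : ℝ) : {β ∈ Set.Icc b₁ b₂ | kappa3 r L β n = 0}.Finite := by
  rcases kappa3_eq_zero_or_finite_zeros r L n with h0 | h0
  · exact absurd (h0 β₁) h
  · exact h0 _ isCompact_Icc

end Wilson

/-- **Registered sub-goal `AnalyticCoupling`** of crux `stmt-QuantumFields-9365` (helper toward stub `GlobalSkewSign`): on
every fixed torus `L` and separation `n`, for every compact `G` and every `LatticeRep`, the crux cumulant `β ↦ κ₃(L, β, n)`
is real-analytic on all of `ℝ`, and either vanishes identically or has only isolated zeros (every `β₀` has a punctured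
neighbourhood free of zeros). -/
theorem AnalyticCoupling :
    ∀ (G : Type) [Group G] [TopologicalSpace G] [IsTopologicalGroup G] [CompactSpace G] [MeasurableSpace G]
      [BorelSpace G] (r : LatticeRep G) (L : ℕ) [NeZero L] (n : ℕ),
      AnalyticOnNhd ℝ (fun β : ℝ => kappa3 r L β n) Set.univ ∧
        ((∀ β : ℝ, kappa3 r L β n = 0) ∨ ∀ β₀ : ℝ, ∀ᶠ β in nhdsWithin β₀ {β₀}ᶜ, kappa3 r L β n ≠ 0) :=
  fun _ _ _ _ _ _ _ r L _ n => ⟨analyticOnNhd_kappa3 r L n, kappa3_zero_set_dichotomy r L n⟩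

end Summit.QuantumFields.YangMills.Theorems.FemtoCurvatureSkewness

end
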